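import Literature.MathematicalPhysics.QuantumLattice.PairedProductStates
import Literature.MathematicalPhysics.QuantumLattice.DopedRVBState
import Literature.MathematicalPhysics.QuantumLattice.HubbardRingPerronFrobeniusProofs
import Literature.MathematicalPhysics.QuantumLattice.FinDimSpectrumSectorGibbsLimit

/-!
# Route `JosephsonMirror` — the free canonical ground energy versus the Fermi-sea energy

Helper file for support item stmt-HubbardSuperconductivity-2232 (`JmFreeLayersNoCusp`) of route
`JosephsonMirror` (sub-problem `HubbardSuperconductivity`): the (easy half of the) equivalence of
ensembles for the FREE Hubbard torus at `T = 0`. For `L ≥ 3` and `m ≤ L²` there is a chemical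
potential `μ'` (a Fermi level of `m` lowest Bloch levels) with

  `e(2m) ≤ Σ_k 2 min(ε_L(k) - μ', 0) + 2m μ'`   (`minEnergyOn_szSector_free_le_fermiSea`),

where `e(2m)` is the lowest energy of `hubbardTorus 2 L 1 0` in the sector `(N = 2m, S^z = 0)` and
the right side is the grand-canonical Fermi-sea energy at `μ'` plus `μ' N`. Ingredients: a
combinatorial threshold lemma (`exists_card_eq_threshold`: `m` levels below a threshold, the rest
above), the fully paired product vectors `Φ_F = Π_{k∈F} b_k† |0⟩` of `PairedProductStates.lean`
(unit norm, kinetic energy `2 Σ_{k∈F} ε_L(k)`), and their sector: `Φ_F ∈ (2|F|, S^z = 0)`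
(`pairedState_mem_szSector`, by `IsInSector.pairCreator_mulVec` mode by mode).

Sources: J. Bardeen, L. N. Cooper, J. R. Schrieffer, Phys. Rev. 108 (1957) 1175, §II (the normal
Fermi sea as the `u = 0, v = 1` product state); D. Ruelle, *Statistical Mechanics* (1969) §3.4
(canonical versus grand-canonical ground energies). Folklore; no new definitions (the product vector
is a local notation, as in `PairedProductStates.lean`).
-/

-- the mandated namespace `Summit.<Summit>.<Problem>.Theorems` repeats `HubbardSuperconductivity`
-- (single-problem summit, D-0017), which the `dupNamespace` linter flags on every declaration
set_option linter.dupNamespace false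

namespace Summit.HubbardSuperconductivity.HubbardSuperconductivity.Theorems.JosephsonMirror

open Matrix Finset Literature.MathematicalPhysics.QuantumLattice Literature.Probability.LatticeModels
open scoped ComplexOrder ComplexConjugate

/-! ### A threshold separating `m` lowest values -/

section Threshold

/-- **Threshold lemma.** For a real function `f` on a finite type and `m ≤ |α|` there are a set
`F` of `m` points and a threshold `μ` with `f ≤ μ` on `F` and `f ≥ μ` off `F` (greedy
selection of lowest values). [folklore] -/
theorem exists_card_eq_threshold {α : Type*} [Fintype α] [DecidableEq α] [Nonempty α]
    (f : α → ℝ) : ∀ m : ℕ, m ≤ Fintype.card α →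
      ∃ F : Finset α, ∃ μ : ℝ, F.card = m ∧ (∀ k ∈ F, f k ≤ μ) ∧ (∀ k ∉ F, μ ≤ f k) := by
  intro m
  induction m with
  | zero =>
    intro _
    obtain ⟨k₀, -, hk₀⟩ := Finset.exists_min_image univ f univ_nonempty
    exact ⟨∅, f k₀, Finset.card_empty, fun k hk => absurd hk (Finset.notMem_empty k),
      fun k _ => hk₀ k (mem_univ k)⟩
  | succ m ih =>
    intro hm
    obtain ⟨F, μ, hF, hle, hge⟩ := ih (Nat.le_of_succ_le hm)
    have hc : (univ \ F).Nonempty := by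
      rw [← Finset.card_pos, Finset.card_sdiff_of_subset (subset_univ F), Finset.card_univ, hF]
      omega
    obtain ⟨k, hk, hkmin⟩ := Finset.exists_min_image (univ \ F) f hc
    have hkF : k ∉ F := (Finset.mem_sdiff.1 hk).2
    refine ⟨insert k F, f k, by rw [Finset.card_insert_of_notMem hkF, hF], ?_, ?_⟩
    · intro j hj
      rcases Finset.mem_insert.1 hj with rfl | hj
      · exact le_rfl
      · exact (hle j hj).trans (hge k hkF)
    · intro j hj
      rw [Finset.mem_insert, not_or] at hj
      exact hkmin j (Finset.mem_sdiff.2 ⟨mem_univ j, hj.2⟩)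

end Threshold

/-! ### The paired product vectors lie in the sector `(2|F|, S^z = 0)` -/

section Paired

variable {L : ℕ} [NeZero L]

/-- The fully paired product vector `Φ_l = Π_{k ∈ l} b†_k |0⟩` (local notation for the literal
term, as in `PairedProductStates.lean`). -/
local notation "Φ[" l "]" =>
  (List.prod (List.map (fun k : TorusSite 2 _ => (pairMode k)ᴴ) l) *ᵥ
    (vacuum : Fock (Orb (FermionTorus 2 _))))

/-- A momentum pair creator `b_k† = c†_{k↑} c†_{-k↓}` raises `(N↑, N↓)` by one each. [folklore] -/
theorem isInSector_pairMode_conjTranspose_mulVec {a b : ℕ} {ψ : Fock (Orb (FermionTorus 2 L))}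
    (hψ : IsInSector a b ψ) (k : TorusSite 2 L) :
    IsInSector (a + 1) (b + 1) ((pairMode k)ᴴ *ᵥ ψ) := by
  rw [pairMode_conjTranspose, momentumCreation_eq_sum, momentumCreation_eq_sum, Finset.sum_mul_sum,
    sum_mulVec]
  refine IsInSector.sum fun x _ => ?_
  rw [sum_mulVec]
  refine IsInSector.sum fun y _ => ?_
  rw [smul_mul_smul_comm, smul_mulVec]
  exact (hψ.pairCreator_mulVec x y).smul _

/-- `Φ_l` lies in the sector `(|l|, |l|)`. [folklore] -/
theorem isInSector_pairedState (l : List (TorusSite 2 L)) : IsInSector l.length l.length (Φ[l]) := by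
  induction l with
  | nil =>
    simp only [List.map_nil, List.prod_nil, one_mulVec, List.length_nil]
    exact IsInSector.vacuum
  | cons k l ih =>
    simp only [List.map_cons, List.prod_cons, ← mulVec_mulVec, List.length_cons]
    exact isInSector_pairMode_conjTranspose_mulVec ih k

/-- `Φ_l ∈ szSector (2|l|) 0`. [folklore] -/
theorem pairedState_mem_szSector (l : List (TorusSite 2 L)) :
    Φ[l] ∈ szSector (2 * l.length) (0 : ℝ) :=
  (mem_szSector_two_mul_zero_iff l.length _).2 (isInSector_pairedState l)

/-- The kinetic energy of the paired vector: `Re ⟨Φ_F, H(1,0) Φ_F⟩ = 2 Σ_{k∈F} ε_L(k)` (`L ≥ 3`;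
`F` listed without repetition). [folklore] -/
theorem re_expect_hubbardTorus_pairedState (hL : 3 ≤ L) (F : Finset (TorusSite 2 L)) :
    (star (Φ[F.toList]) ⬝ᵥ hubbardTorus 2 L 1 0 *ᵥ Φ[F.toList]).re = 2 * ∑ k ∈ F, torusBand L k := by
  have hnd : F.toList.Nodup := F.nodup_toList
  have hmem : ∀ q, q ∈ F.toList ↔ q ∈ F := fun q => Finset.mem_toList
  rw [← hubbardTorusWith_zero, hubbardTorusWith_zero_eq_sum_pairBlock_kinetic hL 0, sum_mulVec,
    dotProduct_sum]
  simp only [smul_mulVec, dotProduct_smul, star_pairedState_dotProduct_pairNumber_mulVec hnd, hmem,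
    smul_eq_mul, mul_ite, mul_zero, sub_zero]
  rw [Complex.re_sum]
  simp only [apply_ite Complex.re, Complex.zero_re]
  rw [← Finset.sum_filter]
  have hfilter : (Finset.univ.filter fun k : TorusSite 2 L => k ∈ F) = F := by
    ext k; simp
  rw [hfilter, Finset.mul_sum]
  refine Finset.sum_congr rfl fun k _ => ?_
  have h : ((torusBand L k : ℝ) : ℂ) * 2 = ((2 * torusBand L k : ℝ) : ℂ) := by push_cast; ring
  rw [h, Complex.ofReal_re]

/-- **Canonical versus Fermi-sea energy for the free torus.** For `L ≥ 3` and `m ≤ L²` there is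
a chemical potential `μ'` with
`e(2m) ≤ Σ_k 2 min(ε_L(k) - μ', 0) + 2 m μ'`, `e(2m) = minEnergyOn (hubbardTorus 2 L 1 0) (szSector 2m 0)`:
fill `m` lowest Bloch levels with both spins (a paired product vector in the sector) and take for
`μ'` their Fermi level. BCS (1957) §II; Ruelle (1969) §3.4. [folklore] -/
theorem minEnergyOn_szSector_free_le_fermiSea (hL : 3 ≤ L) {m : ℕ} (hm : m ≤ L ^ 2) :
    ∃ μ' : ℝ, (hubbardTorus 2 L 1 0).minEnergyOn (szSector (2 * m) 0) ≤
      ∑ k : TorusSite 2 L, 2 * min (torusBand L k - μ') 0 + 2 * m * μ' := by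
  classical
  have hcard : m ≤ Fintype.card (TorusSite 2 L) := by
    have h : Fintype.card (TorusSite 2 L) = L ^ 2 := by simp [ZMod.card]
    rwa [h]
  haveI : Nonempty (TorusSite 2 L) := ⟨0⟩
  obtain ⟨F, μ', hF, hle, hge⟩ := exists_card_eq_threshold (fun k : TorusSite 2 L => torusBand L k) m hcard
  refine ⟨μ', ?_⟩
  -- the trial state
  have hlen : F.toList.length = m := by rw [Finset.length_toList, hF]
  have hmemS : Φ[F.toList] ∈ szSector (2 * m) (0 : ℝ) := by
    have h := pairedState_mem_szSector (L := L) F.toList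
    rwa [hlen] at h
  have h1 : star (Φ[F.toList]) ⬝ᵥ Φ[F.toList] = 1 := star_pairedState_dotProduct_self F.nodup_toList
  have hH : (hubbardTorus 2 L 1 0).IsHermitian := by
    rw [← hubbardTorusWith_zero]
    exact isHermitian_hamiltonianWith_zero (fermionTorusGraph 2 L) 1 0
  refine (minEnergyOn_le_rayleigh_of_mem hH _ hmemS h1).trans ?_
  rw [re_expect_hubbardTorus_pairedState hL F]
  -- `2 Σ_F ε = Σ_k 2 min(ε - μ', 0) + 2 m μ'`
  have hpt : ∀ k ∈ F, torusBand L k = min (torusBand L k - μ') 0 + μ' := fun k hk => by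
    rw [min_eq_left (by linarith [hle k hk])]
    ring
  have hsumF : ∑ k ∈ F, torusBand L k = ∑ k ∈ F, min (torusBand L k - μ') 0 + m * μ' := by
    rw [Finset.sum_congr rfl hpt, Finset.sum_add_distrib, Finset.sum_const, nsmul_eq_mul, hF]
  have hsumU : ∑ k ∈ F, min (torusBand L k - μ') 0 = ∑ k, min (torusBand L k - μ') 0 :=
    Finset.sum_subset (subset_univ F) fun k _ hk => min_eq_right (by linarith [hge k hk])
  rw [hsumF, hsumU, ← Finset.mul_sum]
  exact le_of_eq (by ring)

end Paired

end Summit.HubbardSuperconductivity.HubbardSuperconductivity.Theorems.JosephsonMirror
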